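import Mathlib.Data.Real.Basic
import Mathlib.LinearAlgebra.Dual.Lemmas
import Mathlib.LinearAlgebra.BilinearMap
import Mathlib.Tactic.Linarith
import Mathlib.Tactic.Ring
import HarnessLib

/-!
# Route `BalabanIR`, crux `BirComplexStableXYR` (item `stmt-HubbardSuperconductivity-14845`),
# line `fat-gaussian-defect-calculus`: stub Q1′ `stub_bilinSquare`

Helper (`--supports`) for the crux
`Summit.HubbardSuperconductivity.HubbardSuperconductivity.Theses.BalabanIR.BirComplexStableXYR`,
line `fat-gaussian-defect-calculus` (chapter 1, the exact Fröhlich–Spencer unfolding of the torus integral),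
stub Q1′ `stub_bilinSquare` (Coulomb square completion, basis-free form of the matrix stub Q1
`stub_coulombSquare`).

**Statement.** Let `U`, `V` be finite-dimensional real vector spaces (pinned `0`-cochains and
`1`-cochains), `B : V →ₗ V →ₗ ℝ` a symmetric positive-semidefinite bilinear form (the thin window form
`q`), `T : U →ₗ V` linear (the coboundary `d₀`) and `a : V` (the integer vortex gauge field).  Then there is
`ψ : U` solving the normal equations `B (T u) (a - T ψ) = 0` for all `u`, and for this `ψ` the square
completes exactly: `B (Tφ − a) (Tφ − a) = B (T(φ−ψ)) (T(φ−ψ)) + B (a − Tψ) (a − Tψ)` for every `φ`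
(`σ := a − Tψ` is the Coulomb strain, `B σ σ` the vortex-loop energy).

**Proof.** SOLVABILITY (finite-dimensional duality): put `S : U →ₗ Dual U`, `S ψ u := B (Tψ) (Tu)` and
`b : Dual U`, `b u := B (Tu) a`.  If `S ψ = 0` then `B (Tψ) (Tψ) = 0`, hence `B (Tψ) w = 0` for every `w`
(degenerate Cauchy–Schwarz for a symmetric positive-semidefinite form: expand
`0 ≤ B ((B w w + 1)•v − (B v w)•w) (…)`), so `b ψ = 0`; thus `b` annihilates `ker S`, i.e.
`b ∈ (ker S).dualAnnihilator = range S.dualMap` (Mathlib `LinearMap.range_dualMap_eq_dualAnnihilator_ker`).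
Writing `b = S.dualMap g` and `g = eval ψ` (`U` is reflexive, `Module.evalEquiv`) gives
`B (Tu) a = b u = g (S u) = S u ψ = B (Tu) (Tψ)` for all `u`.  SQUARE: `Tφ − a = T(φ−ψ) − σ`; expand, the
cross terms `B (T(φ−ψ)) σ` and `B σ (T(φ−ψ))` vanish by the normal equation and symmetry. [folklore]

Everything used is Mathlib linear algebra; no definition and no named fact is introduced.
-/

set_option linter.dupNamespace false -- summit = problem name (single-conjunct summit), D-0017

namespace Summit.HubbardSuperconductivity.HubbardSuperconductivity.Theorems.FSUnfolding

section BilinSquare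

variable {U V : Type*} [AddCommGroup U] [Module ℝ U] [AddCommGroup V] [Module ℝ V]

/-- Degenerate Cauchy–Schwarz for a symmetric positive-semidefinite real bilinear form:
`B v v = 0` forces `B v w = 0` for every `w` (expand `0 ≤ B x x` at `x := (B w w + 1) • v - (B v w) • w`,
which gives `(B v w)² · (B w w + 2) ≤ 0`). [folklore] -/
theorem bilin_apply_eq_zero_of_apply_self_eq_zero (B : V →ₗ[ℝ] V →ₗ[ℝ] ℝ)
    (hsymm : ∀ v w : V, B v w = B w v) (hpos : ∀ v : V, 0 ≤ B v v) {v : V} (hv : B v v = 0)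
    (w : V) : B v w = 0 := by
  have h := hpos ((B w w + 1) • v - B v w • w)
  have hexp : B ((B w w + 1) • v - B v w • w) ((B w w + 1) • v - B v w • w) =
      (B w w + 1) ^ 2 * B v v - 2 * (B w w + 1) * B v w * B v w + B v w ^ 2 * B w w := by
    simp only [map_sub, map_smul, LinearMap.sub_apply, LinearMap.smul_apply, smul_eq_mul]
    rw [hsymm w v]
    ring
  rw [hexp, hv] at h
  have hw : 0 ≤ B w w := hpos w
  have hc : B v w * B v w ≤ 0 := by
    nlinarith [mul_nonneg hw (mul_self_nonneg (B v w)), mul_self_nonneg (B v w)]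
  exact mul_self_eq_zero.mp (le_antisymm hc (mul_self_nonneg _))

/-- Solvability of the normal equations, basis-free: for a symmetric positive-semidefinite form `B` on a
real vector space `V`, a linear map `T : U →ₗ V` from a finite-dimensional `U` and any `a : V`, there is
`ψ : U` with `B (T u) (a - T ψ) = 0` for all `u` (the functional `u ↦ B (T u) a` kills
`ker (ψ ↦ B (Tψ) (T·))` by degenerate Cauchy–Schwarz, hence lies in the range of its dual map, which is the
map itself under `U ≃ Dual (Dual U)`). [folklore] -/
theorem bilin_normal_solvable [FiniteDimensional ℝ U] (B : V →ₗ[ℝ] V →ₗ[ℝ] ℝ) (T : U →ₗ[ℝ] V)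
    (a : V) (hsymm : ∀ v w : V, B v w = B w v) (hpos : ∀ v : V, 0 ≤ B v v) :
    ∃ ψ : U, ∀ u : U, B (T u) (a - T ψ) = 0 := by
  -- `S ψ u = B (T ψ) (T u)`, `b u = B (T u) a`
  set S : U →ₗ[ℝ] Module.Dual ℝ U := B.compl₁₂ T T with hS
  set b : Module.Dual ℝ U := (B.flip a).comp T with hb
  have hbS : b ∈ (LinearMap.ker S).dualAnnihilator := by
    rw [Submodule.mem_dualAnnihilator]
    intro ψ hψ
    rw [LinearMap.mem_ker] at hψ
    have h0 : B (T ψ) (T ψ) = 0 := by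
      have := LinearMap.congr_fun hψ ψ
      simpa [S, LinearMap.compl₁₂_apply] using this
    have := bilin_apply_eq_zero_of_apply_self_eq_zero B hsymm hpos h0 a
    simpa [b] using this
  rw [← LinearMap.range_dualMap_eq_dualAnnihilator_ker] at hbS
  obtain ⟨g, hg⟩ := hbS
  refine ⟨(Module.evalEquiv ℝ U).symm g, fun u => ?_⟩
  have hu := LinearMap.congr_fun hg u
  rw [LinearMap.dualMap_apply, ← Module.apply_evalEquiv_symm_apply ℝ U (S u) g] at hu
  simp only [S, b, LinearMap.compl₁₂_apply, LinearMap.comp_apply, LinearMap.flip_apply] at hu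
  rw [map_sub, ← hu, sub_self]

/-- Completing the square, basis-free: if `ψ` solves the normal equations `B (T u) (a - T ψ) = 0` for
all `u` (with `B` symmetric), then for every `φ`
`B (Tφ − a) (Tφ − a) = B (T(φ−ψ)) (T(φ−ψ)) + B (a − Tψ) (a − Tψ)`: with `σ := a − Tψ` one has
`Tφ − a = T(φ−ψ) − σ`, and both cross terms are the normal equation at `u := φ − ψ`. [folklore] -/
theorem bilin_complete_square (B : V →ₗ[ℝ] V →ₗ[ℝ] ℝ) (T : U →ₗ[ℝ] V) (a : V)
    (hsymm : ∀ v w : V, B v w = B w v) (ψ : U) (hψ : ∀ u : U, B (T u) (a - T ψ) = 0) (φ : U) :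
    B (T φ - a) (T φ - a) = B (T (φ - ψ)) (T (φ - ψ)) + B (a - T ψ) (a - T ψ) := by
  have hdecomp : T φ - a = T (φ - ψ) - (a - T ψ) := by
    rw [map_sub]
    abel
  have hcross : B (T (φ - ψ)) (a - T ψ) = 0 := hψ (φ - ψ)
  have hcross' : B (a - T ψ) (T (φ - ψ)) = 0 := by
    rw [hsymm, hcross]
  rw [hdecomp]
  set x := T (φ - ψ)
  set σ := a - T ψ
  simp only [map_sub, LinearMap.sub_apply]
  rw [hcross, hcross']
  ring

/-- **stub Q1′ (M): Coulomb square completion, basis-free.**  For finite-dimensional real vector spaces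
`U` (pinned `0`-cochains) and `V` (`1`-cochains), a symmetric positive-semidefinite bilinear form
`B : V →ₗ V →ₗ ℝ` (the thin window form `q`), a linear map `T : U →ₗ V` (the coboundary `d₀`) and
`a : V` (the integer vortex gauge field): the normal equations `B (T u) (a − Tψ) = 0 ∀ u` have a solution
`ψ`, and for it the square completes exactly,
`B (Tφ − a) (Tφ − a) = B (T(φ−ψ)) (T(φ−ψ)) + B (a − Tψ) (a − Tψ)` for every `φ`
(`σ := a − Tψ` is the Coulomb strain, `B σ σ` the vortex-loop energy).  Basis-free form of the matrix
stub Q1 `stub_coulombSquare`; finite-dimensionality of `V` is part of the registered signature and is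
not used. [folklore] -/
theorem stub_bilinSquare :
    ∀ (U V : Type) [AddCommGroup U] [Module ℝ U] [AddCommGroup V] [Module ℝ V]
      [FiniteDimensional ℝ U] [FiniteDimensional ℝ V]
      (B : V →ₗ[ℝ] V →ₗ[ℝ] ℝ) (T : U →ₗ[ℝ] V) (a : V),
      (∀ v w : V, B v w = B w v) → (∀ v : V, 0 ≤ B v v) →
      ∃ ψ : U, (∀ u : U, B (T u) (a - T ψ) = 0) ∧
        ∀ φ : U, B (T φ - a) (T φ - a) = B (T (φ - ψ)) (T (φ - ψ)) + B (a - T ψ) (a - T ψ) := by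
  intro U V _ _ _ _ _ _ B T a hsymm hpos
  obtain ⟨ψ, hψ⟩ := bilin_normal_solvable B T a hsymm hpos
  exact ⟨ψ, hψ, fun φ => bilin_complete_square B T a hsymm ψ hψ φ⟩

end BilinSquare

end Summit.HubbardSuperconductivity.HubbardSuperconductivity.Theorems.FSUnfolding
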